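import Literature.Geometry.Manifold.SmoothSingularChains
import Literature.AlgebraicTopology.SingularHomology.CechSingular
import HarnessLib

/-!
# The Čech–smooth-singular double complex: smooth singular cochains of a family of subsets

The SMOOTH counterpart of `Literature/AlgebraicTopology/SingularHomology/CechSingular.lean` (the
Čech–singular double complex `C^p(𝔘, C^q) = Π_J Hom_R(C_q(U_J), N)` of a family of subsets, with
exact rows augmented by the `𝔘`-small cochains and columns augmented by the `0`-cocycles): here the
chains `C_q(U_J)` are replaced by the **smooth** singular chains `Δ^{sm}_q(U_J)` of a `C^∞` manifold
`M` (`Literature.Geometry.Manifold.smoothChainsInSub`, Bredon (1993), §V.9), the only chains on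
which differential forms can be integrated. Everything else is verbatim: the Čech differential `δ`
((8.4) of Bott–Tu) horizontally, `(-1)^p` times the singular coboundary vertically, exactness of the
rows augmented by the smooth `𝔘`-small cochains `Hom_R(Δ^{sm,𝔘}_q, N)` with no hypothesis on `𝔘`
(the index-choice contraction), exactness of the columns augmented by the Čech complex of smooth
`0`-cocycles as soon as every `U_J` is acyclic for smooth cochains in positive degrees, and the
comparison `cechSmoothSingularEquiv : Hⁿ(Hom(Δ^{sm,𝔘}, N)) ≃ₗ[R] Hⁿ(C^•(𝔘, Z⁰_{sm}), δ)`
(`Literature.Algebra.Homology.ADoubleComplex.rowColEquiv`). This is the double complex in which the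
de Rham homomorphism (integration, `Literature.Geometry.Manifold.deRhamMap`) realises the Čech–de
Rham zigzag of a closed form inside singular cochains (Weil 1952, §3; Bott–Tu Thm. 8.9 with
Thm. 15.8), e.g. for the Čech integrality step of Lefschetz's theorem on `(1,1)`-classes.

No topology is used beyond the types; no named facts; everything is proved.

## References

* R. Bott, L. W. Tu, *Differential Forms in Algebraic Topology*, GTM 82 (1982), §8 (Prop. 8.5,
  Thm. 8.9), §15 (Thm. 15.8). [BottTu1982Forms]
* G. E. Bredon, *Topology and Geometry*, GTM 139 (1993), §V.5, §V.9. [Bredon1993]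
* A. Weil, *Sur les théorèmes de de Rham*, Comment. Math. Helv. 26 (1952), §3.
-/

noncomputable section

-- as in `CechSingular`: chains of the concrete complex are `Finsupp`s up to unfolding
set_option backward.isDefEq.respectTransparency false

open scoped Manifold ContDiff
open CategoryTheory Literature.Algebra.Homology Literature.AlgebraicTopology.SingularHomology

universe u v w

namespace Literature.Geometry.Manifold

variable {E : Type*} [NormedAddCommGroup E] [NormedSpace ℝ E]
  {H : Type*} [TopologicalSpace H] {I : ModelWithCorners ℝ E H}
  {R : Type v} [CommRing R] {M : Type u} [TopologicalSpace M] [ChartedSpace H M]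
  {N : Type w} [AddCommGroup N] [Module R N] {ι : Type*}

/-! ### Concrete smooth cochains of a subset, restriction, coboundary -/

variable (I R N) in
/-- **Smooth singular `q`-cochains of `A ⊆ M` with values in `N`**: `R`-linear maps
`Δ^{sm}_q(A; R) →ₗ[R] N` on the smooth chains with image in `A`. [cite: Bredon1993, §V.9] -/
abbrev SCochainOn (A : Set M) (q : ℕ) : Type _ :=
  ((smoothChainsInSub I R R M A).toComplex.X q) →ₗ[R] N

/-- **Restriction of smooth cochains** along `A ⊆ B`. [cite: Bredon1993, §V.9] -/
def scres {A B : Set M} (h : A ⊆ B) (q : ℕ) : SCochainOn I R N B q →ₗ[R] SCochainOn I R N A q where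
  toFun ψ := ψ ∘ₗ ((Subcomplex.incl (smoothChainsInSub_mono (I := I) (R := R) (A := R) (M := M) h)).f q).hom
  map_add' _ _ := LinearMap.add_comp _ _ _
  map_smul' _ _ := LinearMap.smul_comp _ _ _

/-- Restriction is precomposition with the inclusion. [folklore] -/
theorem scres_apply {A B : Set M} (h : A ⊆ B) {q : ℕ} (ψ : SCochainOn I R N B q)
    (c : (smoothChainsInSub I R R M A).toComplex.X q) :
    scres h q ψ c = ψ (((Subcomplex.incl (smoothChainsInSub_mono (I := I) (R := R) (A := R)
      (M := M) h)).f q).hom c) :=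
  rfl

/-- **The coboundary** `ψ ↦ ψ ∘ ∂` on the smooth cochains of `A`. [cite: Bredon1993, §V.9] -/
def scod (A : Set M) (q : ℕ) : SCochainOn I R N A q →ₗ[R] SCochainOn I R N A (q + 1) where
  toFun ψ := ψ ∘ₗ ((smoothChainsInSub I R R M A).toComplex.d (q + 1) q).hom
  map_add' _ _ := LinearMap.add_comp _ _ _
  map_smul' _ _ := LinearMap.smul_comp _ _ _

/-- The coboundary is precomposition with the boundary. [folklore] -/
theorem scod_apply {A : Set M} {q : ℕ} (ψ : SCochainOn I R N A q)
    (c : (smoothChainsInSub I R R M A).toComplex.X (q + 1)) :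
    scod A q ψ c = ψ (((smoothChainsInSub I R R M A).toComplex.d (q + 1) q).hom c) :=
  rfl

/-- `δ ∘ δ = 0` (`∂ ∘ ∂ = 0`). [folklore] -/
theorem scod_scod {A : Set M} {q : ℕ} (ψ : SCochainOn I R N A q) : scod A (q + 1) (scod A q ψ) = 0 := by
  have h := congrArg (ModuleCat.Hom.hom (R := R))
    ((smoothChainsInSub I R R M A).toComplex.d_comp_d (q + 1 + 1) (q + 1) q)
  rw [ModuleCat.hom_comp, ModuleCat.hom_zero] at h
  change (ψ ∘ₗ ((smoothChainsInSub I R R M A).toComplex.d (q + 1) q).hom) ∘ₗ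
    ((smoothChainsInSub I R R M A).toComplex.d (q + 1 + 1) (q + 1)).hom = 0
  rw [LinearMap.comp_assoc, h, LinearMap.comp_zero]

/-- Restriction commutes with the coboundary. [folklore] -/
theorem scres_scod {A B : Set M} (h : A ⊆ B) {q : ℕ} (ψ : SCochainOn I R N B q) :
    scres h (q + 1) (scod B q ψ) = scod A q (scres h q ψ) := by
  have hc := congrArg (ModuleCat.Hom.hom (R := R))
    ((Subcomplex.incl (smoothChainsInSub_mono (I := I) (R := R) (A := R) (M := M) h)).comm (q + 1) q)
  rw [ModuleCat.hom_comp, ModuleCat.hom_comp] at hc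
  change (ψ ∘ₗ ((smoothChainsInSub I R R M B).toComplex.d (q + 1) q).hom) ∘ₗ
      ((Subcomplex.incl (smoothChainsInSub_mono (I := I) (R := R) (A := R) (M := M) h)).f (q + 1)).hom =
    (ψ ∘ₗ ((Subcomplex.incl (smoothChainsInSub_mono (I := I) (R := R) (A := R) (M := M) h)).f q).hom) ∘ₗ
      ((smoothChainsInSub I R R M A).toComplex.d (q + 1) q).hom
  rw [LinearMap.comp_assoc, hc, ← LinearMap.comp_assoc]

/-- Restrictions compose. [folklore] -/
theorem scres_scres {A B C : Set M} (h : A ⊆ B) (h' : B ⊆ C) {q : ℕ} (ψ : SCochainOn I R N C q) :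
    scres h q (scres h' q ψ) = scres (h.trans h') q ψ := by
  have hc := congrArg (fun φ ↦ ModuleCat.Hom.hom (R := R) (HomologicalComplex.Hom.f φ q))
    (Subcomplex.incl_comp_incl (smoothChainsInSub_mono (I := I) (R := R) (A := R) (M := M) h)
      (smoothChainsInSub_mono (I := I) (R := R) (A := R) (M := M) h'))
  simp only [HomologicalComplex.comp_f, ModuleCat.hom_comp] at hc
  change (ψ ∘ₗ _) ∘ₗ _ = ψ ∘ₗ _
  rw [LinearMap.comp_assoc, hc]

/-! ### Elementary smooth chains and the values of a cochain on smooth simplices -/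

/-- A **smooth simplex of `A`**: smooth, with image in `A`. [folklore] -/
def IsSmoothIn (I : ModelWithCorners ℝ E H) (A : Set M) {q : ℕ} (σ : SingularSimplex M q) : Prop :=
  σ.IsSmooth I ∧ σ.range ⊆ A

/-- Smooth simplices of a smaller set are smooth simplices of a bigger one. [folklore] -/
theorem IsSmoothIn.mono {A B : Set M} (h : A ⊆ B) {q : ℕ} {σ : SingularSimplex M q}
    (hσ : IsSmoothIn I A σ) : IsSmoothIn I B σ :=
  ⟨hσ.1, hσ.2.trans h⟩

/-- The elementary chain of a smooth simplex of `A`, as an element of `Δ^{sm}_q(A)`. [folklore] -/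
def sElemChain {A : Set M} {q : ℕ} {σ : SingularSimplex M q} (hσ : IsSmoothIn I A σ) :
    (smoothChainsInSub I R R M A).toComplex.X q :=
  ⟨Finsupp.single σ (1 : R), single_mem_smoothChainsInSub hσ.1 hσ.2 1⟩

/-- The underlying chain of an elementary chain. [folklore] -/
theorem coe_sElemChain {A : Set M} {q : ℕ} {σ : SingularSimplex M q} (hσ : IsSmoothIn I A σ) :
    (sElemChain (R := R) hσ : (smoothChainsInSub I R R M A).toComplex.X q).1 = Finsupp.single σ 1 :=
  rfl

/-- The inclusion of chains sends elementary chains to elementary chains. [folklore] -/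
theorem incl_sElemChain {A B : Set M} (h : A ⊆ B) {q : ℕ} {σ : SingularSimplex M q}
    (hσ : IsSmoothIn I A σ) :
    ((Subcomplex.incl (smoothChainsInSub_mono (I := I) (R := R) (A := R) (M := M) h)).f q).hom
        (sElemChain (R := R) hσ) = sElemChain (hσ.mono h) :=
  rfl

open Classical in
/-- **The value of a smooth cochain on a simplex, extended by zero**: `ψ(σ)` if `σ` is a smooth
simplex of `A`, else `0`. [folklore] -/
def sEvalSimplex {A : Set M} {q : ℕ} (ψ : SCochainOn I R N A q) (σ : SingularSimplex M q) : N :=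
  if h : IsSmoothIn I A σ then ψ (sElemChain h) else 0

/-- The value on a smooth simplex of `A`. [folklore] -/
theorem sEvalSimplex_of_isSmoothIn {A : Set M} {q : ℕ} (ψ : SCochainOn I R N A q)
    {σ : SingularSimplex M q} (hσ : IsSmoothIn I A σ) : sEvalSimplex ψ σ = ψ (sElemChain hσ) := by
  rw [sEvalSimplex, dif_pos hσ]

/-- `sEvalSimplex` is additive in the cochain. [folklore] -/
theorem sEvalSimplex_add {A : Set M} {q : ℕ} (ψ ψ' : SCochainOn I R N A q) (σ : SingularSimplex M q) :
    sEvalSimplex (ψ + ψ') σ = sEvalSimplex ψ σ + sEvalSimplex ψ' σ := by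
  by_cases h : IsSmoothIn I A σ
  · rw [sEvalSimplex_of_isSmoothIn _ h, sEvalSimplex_of_isSmoothIn _ h, sEvalSimplex_of_isSmoothIn _ h,
      LinearMap.add_apply]
  · simp only [sEvalSimplex, dif_neg h, add_zero]

/-- `sEvalSimplex` is homogeneous in the cochain. [folklore] -/
theorem sEvalSimplex_smul {A : Set M} {q : ℕ} (r : R) (ψ : SCochainOn I R N A q)
    (σ : SingularSimplex M q) : sEvalSimplex (r • ψ) σ = r • sEvalSimplex ψ σ := by
  by_cases h : IsSmoothIn I A σ
  · rw [sEvalSimplex_of_isSmoothIn _ h, sEvalSimplex_of_isSmoothIn _ h, LinearMap.smul_apply]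
  · simp only [sEvalSimplex, dif_neg h, smul_zero]

/-- `sEvalSimplex` of a finite sum of cochains. [folklore] -/
theorem sEvalSimplex_sum {A : Set M} {q : ℕ} {β : Type*} (s : Finset β) (ψ : β → SCochainOn I R N A q)
    (σ : SingularSimplex M q) : sEvalSimplex (∑ b ∈ s, ψ b) σ = ∑ b ∈ s, sEvalSimplex (ψ b) σ := by
  classical
  induction s using Finset.induction_on with
  | empty =>
    by_cases h : IsSmoothIn I A σ
    · rw [Finset.sum_empty, Finset.sum_empty, sEvalSimplex_of_isSmoothIn _ h, LinearMap.zero_apply]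
    · simp only [Finset.sum_empty, sEvalSimplex, dif_neg h]
  | insert b s hb ih => rw [Finset.sum_insert hb, Finset.sum_insert hb, sEvalSimplex_add, ih]

/-- **Restriction does not change the values on the smooth simplices of the smaller set.**
[folklore] -/
theorem sEvalSimplex_scres {A B : Set M} (h : A ⊆ B) {q : ℕ} (ψ : SCochainOn I R N B q)
    {σ : SingularSimplex M q} (hσ : IsSmoothIn I A σ) :
    sEvalSimplex (scres h q ψ) σ = sEvalSimplex ψ σ := by
  rw [sEvalSimplex_of_isSmoothIn _ hσ, sEvalSimplex_of_isSmoothIn _ (hσ.mono h), scres_apply,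
    incl_sElemChain h]

/-- The simplices of a chain of `Δ^{sm}(A)` are smooth simplices of `A`. [folklore] -/
theorem isSmoothIn_of_mem_support {A : Set M} {q : ℕ} (x : (smoothChainsInSub I R R M A).toComplex.X q)
    {σ : SingularSimplex M q} (hσ : σ ∈ (x.1 : CChain R M q).support) : IsSmoothIn I A σ :=
  ⟨(mem_smoothChains_iff _).1 x.2.1 σ hσ, (mem_chainsIn_iff R R _).1 x.2.2 σ hσ⟩

/-- **A smooth cochain of `A` is determined by its values on the smooth simplices of `A`**
(`Δ^{sm}_q(A)` is free on them). [cite: Bredon1993, §V.5] -/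
theorem ext_sEvalSimplex {A : Set M} {q : ℕ} {ψ ψ' : SCochainOn I R N A q}
    (h : ∀ σ : SingularSimplex M q, IsSmoothIn I A σ → sEvalSimplex ψ σ = sEvalSimplex ψ' σ) :
    ψ = ψ' := by
  classical
  set ρ := Finsupp.restrictDom R R {σ : SingularSimplex M q | IsSmoothIn I A σ} with hρ
  -- `ρ` lands in `Δ^{sm}_q(A)`: transport along the identification of the supporting sets
  have hsupp : ∀ c : CChain R M q, c ∈ Finsupp.supported R R {σ : SingularSimplex M q | IsSmoothIn I A σ} →
      c ∈ smoothChainsInSub I R R M A q := by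
    intro c hc
    rw [Finsupp.mem_supported'] at hc
    refine ⟨(mem_smoothChains_iff _).2 fun σ hσ ↦ ?_, (mem_chainsIn_iff R R _).2 fun σ hσ ↦ ?_⟩
    · by_contra hns
      exact (Finsupp.mem_support_iff.1 hσ) (hc σ fun hh ↦ hns hh.1)
    · by_contra hns
      exact (Finsupp.mem_support_iff.1 hσ) (hc σ fun hh ↦ hns hh.2)
  let ρ' : CChain R M q →ₗ[R] (smoothChainsInSub I R R M A).toComplex.X q :=
    { toFun := fun c ↦ ⟨(ρ c).1, hsupp _ (ρ c).2⟩
      map_add' := fun c c' ↦ Subtype.ext (by rw [map_add]; rfl)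
      map_smul' := fun r c ↦ Subtype.ext (by rw [map_smul]; rfl) }
  have key : ψ ∘ₗ ρ' = ψ' ∘ₗ ρ' := by
    refine Finsupp.lhom_ext fun σ b ↦ ?_
    change ψ (ρ' (Finsupp.single σ b)) = ψ' (ρ' (Finsupp.single σ b))
    by_cases hσ : IsSmoothIn I A σ
    · have e : ρ' (Finsupp.single σ b) = b • sElemChain (R := R) hσ := by
        apply Subtype.ext
        change (ρ (Finsupp.single σ b)).1 = b • Finsupp.single σ (1 : R)
        rw [hρ, Finsupp.restrictDom_apply, Finsupp.smul_single_one]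
        exact Finsupp.filter_single_of_pos (p := (· ∈ {σ : SingularSimplex M q | IsSmoothIn I A σ})) hσ
      rw [e, map_smul, map_smul, ← sEvalSimplex_of_isSmoothIn ψ hσ, ← sEvalSimplex_of_isSmoothIn ψ' hσ,
        h σ hσ]
    · have e : ρ' (Finsupp.single σ b) = 0 := by
        apply Subtype.ext
        change (ρ (Finsupp.single σ b)).1 = 0
        rw [hρ, Finsupp.restrictDom_apply]
        exact Finsupp.filter_single_of_neg (p := (· ∈ {σ : SingularSimplex M q | IsSmoothIn I A σ})) hσ
      rw [e, map_zero, map_zero]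
  refine LinearMap.ext fun x ↦ ?_
  have hx : ρ' (x.1 : CChain R M q) = x := by
    apply Subtype.ext
    change (ρ (x.1 : CChain R M q)).1 = x.1
    rw [hρ, Finsupp.restrictDom_apply, Finsupp.filter_eq_self_iff]
    intro σ hσ
    exact isSmoothIn_of_mem_support x (Finsupp.mem_support_iff.mpr hσ)
  have e := congrArg (fun f ↦ f (x.1 : CChain R M q)) key
  change ψ (ρ' (x.1 : CChain R M q)) = ψ' (ρ' (x.1 : CChain R M q)) at e
  rwa [hx] at e

/-! ### The Čech–smooth-singular double complex -/

variable (I R N) in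
/-- **The Čech `p`-cochains with values in smooth singular `q`-cochains**,
`C^p(𝔘, C^q_{sm}) = Π_J C^q_{sm}(U_J; N)` over all ordered `(p+1)`-tuples. [cite: BottTu1982Forms, §15 Thm. 15.8] -/
abbrev CechSCochain (U : ι → Set M) (p q : ℕ) : Type _ :=
  ∀ J : Fin (p + 1) → ι, SCochainOn I R N (cechSet U J) q

section Cech

variable (U : ι → Set M)

variable (I R N) in
/-- **The Čech differential** `(δ c)_J = Σ_j (-1)^j c_{J ∘ σ_j}|_{U_J}` ((8.4) of Bott–Tu).
[cite: BottTu1982Forms, §8 (8.4)] -/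
def cechSδ (p q : ℕ) : CechSCochain I R N U p q →ₗ[R] CechSCochain I R N U (p + 1) q where
  toFun c J := ∑ j : Fin (p + 2), (-1 : R) ^ (j : ℕ) •
    scres (cechSet_subset_comp U J (Fin.succAbove j)) q (c (J ∘ Fin.succAbove j))
  map_add' c c' := by
    funext J
    simp only [Pi.add_apply, map_add, smul_add, Finset.sum_add_distrib]
  map_smul' r c := by
    funext J
    simp only [Pi.smul_apply, map_smul, RingHom.id_apply, Finset.smul_sum, smul_smul, mul_comm r]

/-- The Čech differential, componentwise. [cite: BottTu1982Forms, §8 (8.4)] -/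
theorem cechSδ_apply {p q : ℕ} (c : CechSCochain I R N U p q) (J : Fin (p + 2) → ι) :
    cechSδ I R N U p q c J = ∑ j : Fin (p + 2), (-1 : R) ^ (j : ℕ) •
      scres (cechSet_subset_comp U J (Fin.succAbove j)) q (c (J ∘ Fin.succAbove j)) :=
  rfl

/-- **The Čech differential on the values**: for a smooth `σ ⊆ U_J`,
`(δ c)_J(σ) = Σ_j (-1)^j c_{J ∘ σ_j}(σ)`. [cite: BottTu1982Forms, §8 (8.4)] -/
theorem sEvalSimplex_cechSδ {p q : ℕ} (c : CechSCochain I R N U p q) {J : Fin (p + 2) → ι}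
    {σ : SingularSimplex M q} (hσ : IsSmoothIn I (cechSet U J) σ) :
    sEvalSimplex (cechSδ I R N U p q c J) σ =
      ∑ j : Fin (p + 2), (-1 : R) ^ (j : ℕ) • sEvalSimplex (c (J ∘ Fin.succAbove j)) σ := by
  rw [cechSδ_apply, sEvalSimplex_sum]
  refine Finset.sum_congr rfl fun j _ ↦ ?_
  rw [sEvalSimplex_smul, sEvalSimplex_scres _ _ hσ]

variable (I R N) in
/-- **The vertical differential** `(-1)^p δ_sing` (Weibel's sign trick). [cite: Weibel1994, 1.2.5] -/
def cechSd (p q : ℕ) : CechSCochain I R N U p q →ₗ[R] CechSCochain I R N U p (q + 1) where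
  toFun c J := (-1 : R) ^ p • scod (cechSet U J) q (c J)
  map_add' c c' := by
    funext J
    simp only [Pi.add_apply, map_add, smul_add]
  map_smul' r c := by
    funext J
    simp only [Pi.smul_apply, map_smul, RingHom.id_apply, smul_comm r]

/-- The vertical differential, componentwise. [cite: Weibel1994, 1.2.5] -/
theorem cechSd_apply {p q : ℕ} (c : CechSCochain I R N U p q) (J : Fin (p + 1) → ι) :
    cechSd I R N U p q c J = (-1 : R) ^ p • scod (cechSet U J) q (c J) :=
  rfl

variable (I R N) in
/-- **The Čech–smooth-singular double complex** `C^p(𝔘, C^q_{sm})` as an anticommuting double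
complex. [cite: BottTu1982Forms, §15 Thm. 15.8] -/
def cechSmoothSingular : ADoubleComplex R (CechSCochain I R N U) where
  d p q := cechSd I R N U p q
  δ p q := cechSδ I R N U p q
  d_d p q c := by
    funext J
    rw [cechSd_apply, cechSd_apply, map_smul, scod_scod, smul_zero, smul_zero]
    rfl
  δ_δ p q c := by
    funext J
    rw [cechSδ_apply, Pi.zero_apply]
    simp_rw [cechSδ_apply, map_sum, map_smul, scres_scres, Finset.smul_sum]
    exact CechTuple.sum_sum_neg_one_pow_smul_smul_faces_eq_zero (R := R)
      (fun θ ↦ scres (cechSet_subset_comp U J θ) q (c (J ∘ θ)))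
  anticomm p q c := by
    funext J
    rw [Pi.add_apply, Pi.zero_apply, cechSδ_apply, cechSd_apply, cechSδ_apply, map_sum, Finset.smul_sum,
      ← Finset.sum_add_distrib]
    refine Finset.sum_eq_zero fun j _ ↦ ?_
    rw [cechSd_apply, map_smul, map_smul, scres_scod, smul_smul, smul_smul, ← add_smul,
      show (-1 : R) ^ (j : ℕ) * (-1) ^ p + (-1) ^ (p + 1) * (-1) ^ (j : ℕ) = 0 by ring, zero_smul]

/-! ### The row augmentation: smooth `𝔘`-small cochains -/

variable (I R) in
/-- **The smooth `𝔘`-small chains** `Δ^{sm,𝔘} = Δ^{sm}(M) ⊓ C^𝔘`: smooth chains each of whose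
simplices lies in some `U_i`. [cite: Bredon1993, §V.9] -/
def smoothSmallSub : Subcomplex (csingularChainComplex R R M) :=
  smoothSub I R R M ⊓ smallSub R R M U

/-- `Δ^{sm}(U_J) ≤ Δ^{sm,𝔘}` for a `1`-tuple `J = (i)`. [folklore] -/
theorem smoothChainsInSub_cechSet_le_smoothSmallSub (J : Fin 1 → ι) :
    smoothChainsInSub I R R M (cechSet U J) ≤ smoothSmallSub I R U :=
  le_inf (smoothChainsInSub_le_smoothSub _)
    ((smoothChainsInSub_le_chainsInSub _).trans (chainsInSub_cechSet_le_smallSub U J))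

variable (I R N) in
/-- **The smooth `𝔘`-small `q`-cochains** `Hom_R(Δ^{sm,𝔘}_q, N)`. [cite: Bredon1993, §V.9] -/
abbrev SmoothSmallCochain (q : ℕ) : Type _ :=
  ((smoothSmallSub I R U).toComplex.X q) →ₗ[R] N

variable (I R N) in
/-- **The row augmentation** by the smooth small cochains: `a ↦ (a|_{Δ^{sm}(U_i)})_i`.
[cite: BottTu1982Forms, §8 Prop. 8.5] -/
def cechSmoothSingularRow : (cechSmoothSingular I R N U).RowAugmentation (SmoothSmallCochain I R N U) where
  dA q :=
    { toFun := fun a ↦ a ∘ₗ ((smoothSmallSub I R U).toComplex.d (q + 1) q).hom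
      map_add' := fun _ _ ↦ LinearMap.add_comp _ _ _
      map_smul' := fun _ _ ↦ LinearMap.smul_comp _ _ _ }
  ε q :=
    { toFun := fun a J ↦ a ∘ₗ ((Subcomplex.incl (smoothChainsInSub_cechSet_le_smoothSmallSub U J)).f q).hom
      map_add' := fun _ _ ↦ by funext J; exact LinearMap.add_comp _ _ _
      map_smul' := fun _ _ ↦ by funext J; exact LinearMap.smul_comp _ _ _ }
  ε_dA q a := by
    funext J
    change (a ∘ₗ ((smoothSmallSub I R U).toComplex.d (q + 1) q).hom) ∘ₗ
        ((Subcomplex.incl (smoothChainsInSub_cechSet_le_smoothSmallSub U J)).f (q + 1)).hom =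
      (-1 : R) ^ 0 • ((a ∘ₗ ((Subcomplex.incl (smoothChainsInSub_cechSet_le_smoothSmallSub U J)).f q).hom) ∘ₗ
        ((smoothChainsInSub I R R M (cechSet U J)).toComplex.d (q + 1) q).hom)
    have hc := congrArg (ModuleCat.Hom.hom (R := R))
      ((Subcomplex.incl (smoothChainsInSub_cechSet_le_smoothSmallSub (I := I) (R := R) U J)).comm
        (q + 1) q)
    rw [ModuleCat.hom_comp, ModuleCat.hom_comp] at hc
    rw [pow_zero, one_smul, LinearMap.comp_assoc, hc, ← LinearMap.comp_assoc]
  δ_ε q a := by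
    funext J
    change cechSδ I R N U 0 q
      (fun J ↦ a ∘ₗ ((Subcomplex.incl (smoothChainsInSub_cechSet_le_smoothSmallSub U J)).f q).hom) J = 0
    rw [cechSδ_apply, Fin.sum_univ_two, Fin.val_zero, pow_zero, one_smul, Fin.val_one, pow_one,
      neg_one_smul, add_neg_eq_zero]
    have key : ∀ j : Fin 2,
        scres (cechSet_subset_comp U J (Fin.succAbove j)) q
          (a ∘ₗ ((Subcomplex.incl (smoothChainsInSub_cechSet_le_smoothSmallSub U (J ∘ Fin.succAbove j))).f q).hom) =
        a ∘ₗ ((Subcomplex.incl ((smoothChainsInSub_mono (I := I) (R := R) (A := R) (M := M)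
          (cechSet_subset_comp U J (Fin.succAbove j))).trans
          (smoothChainsInSub_cechSet_le_smoothSmallSub U (J ∘ Fin.succAbove j)))).f q).hom := by
      intro j
      have hc := congrArg (fun φ ↦ ModuleCat.Hom.hom (R := R) (HomologicalComplex.Hom.f φ q))
        (Subcomplex.incl_comp_incl (smoothChainsInSub_mono (I := I) (R := R) (A := R) (M := M)
          (cechSet_subset_comp U J (Fin.succAbove j)))
          (smoothChainsInSub_cechSet_le_smoothSmallSub U (J ∘ Fin.succAbove j)))
      simp only [HomologicalComplex.comp_f, ModuleCat.hom_comp] at hc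
      change (a ∘ₗ _) ∘ₗ _ = _
      rw [LinearMap.comp_assoc, hc]
    rw [key, key]

/-- The row augmentation on the values: `(r a)_J(σ) = a(σ)` for a smooth `σ ⊆ U_J`. [folklore] -/
theorem cechSmoothSingularRow_ε_apply_sElemChain {q : ℕ} (a : SmoothSmallCochain I R N U q) (J : Fin 1 → ι)
    {σ : SingularSimplex M q} (hσ : IsSmoothIn I (cechSet U J) σ) :
    (cechSmoothSingularRow I R N U).ε q a J (sElemChain hσ) =
      a ⟨Finsupp.single σ 1, smoothChainsInSub_cechSet_le_smoothSmallSub U J q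
        (single_mem_smoothChainsInSub hσ.1 hσ.2 1)⟩ :=
  rfl

/-! ### Exactness of the rows: the index-choice contraction -/

/-- A smooth simplex of `U_J` is a smooth simplex of `U_{(smallIdx σ, J)}`. [folklore] -/
theorem isSmoothIn_cechSet_cons_smallIdx {p p' q : ℕ} (J : Fin (p + 1) → ι) (J' : Fin (p' + 1) → ι)
    {σ : SingularSimplex M q} (hσ : IsSmoothIn I (cechSet U J) σ) :
    IsSmoothIn I (cechSet U (Fin.cons (smallIdx U J' σ) J : Fin (p + 2) → ι)) σ :=
  ⟨hσ.1, subset_cechSet_cons_smallIdx U J J' hσ.2⟩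

open Classical in
/-- **The contracting homotopy** `(h c)_J(σ) = c_{(smallIdx σ, J)}(σ)` on the free module
`Δ^{sm}_q(U_J)`. [cite: BottTu1982Forms, Prop. 8.5] -/
def cechSContract {p q : ℕ} (c : CechSCochain I R N U (p + 1) q) (J : Fin (p + 1) → ι) :
    SCochainOn I R N (cechSet U J) q where
  toFun x := Finsupp.linearCombination R (fun σ : SingularSimplex M q ↦
      if h : IsSmoothIn I (cechSet U J) σ then
        c (Fin.cons (smallIdx U J σ) J) (sElemChain (isSmoothIn_cechSet_cons_smallIdx U J J h))
      else 0) x.1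
  map_add' x y := map_add _ x.1 y.1
  map_smul' r x := map_smul _ r x.1

/-- The value of the contraction on a smooth simplex of `U_J`. [cite: BottTu1982Forms, Prop. 8.5] -/
theorem sEvalSimplex_cechSContract {p q : ℕ} (c : CechSCochain I R N U (p + 1) q) (J : Fin (p + 1) → ι)
    {σ : SingularSimplex M q} (hσ : IsSmoothIn I (cechSet U J) σ) :
    sEvalSimplex (cechSContract U c J) σ = sEvalSimplex (c (Fin.cons (smallIdx U J σ) J)) σ := by
  classical
  rw [sEvalSimplex_of_isSmoothIn _ hσ,
    sEvalSimplex_of_isSmoothIn _ (isSmoothIn_cechSet_cons_smallIdx U J J hσ)]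
  change Finsupp.linearCombination R _ (Finsupp.single σ 1) = _
  rw [Finsupp.linearCombination_single, one_smul, dif_pos hσ]

/-- **The cocycle identity behind the contraction**: if `δ c = 0` then for a smooth `σ ⊆ U_i ∩ U_J`,
`c_J(σ) = Σ_j (-1)^j c_{(i, J ∘ σ_j)}(σ)`. [cite: BottTu1982Forms, Prop. 8.5] -/
theorem sEvalSimplex_eq_sum_of_cechSδ_eq_zero {p q : ℕ} {c : CechSCochain I R N U (p + 1) q}
    (hc : cechSδ I R N U (p + 1) q c = 0) (J : Fin (p + 2) → ι) (i : ι) {σ : SingularSimplex M q}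
    (hσi : σ.range ⊆ U i) (hσ : IsSmoothIn I (cechSet U J) σ) :
    sEvalSimplex (c J) σ = ∑ j : Fin (p + 2), (-1 : R) ^ (j : ℕ) •
      sEvalSimplex (c (Fin.cons i (J ∘ Fin.succAbove j) : Fin (p + 2) → ι)) σ := by
  have hσc : IsSmoothIn I (cechSet U (Fin.cons i J : Fin (p + 3) → ι)) σ := by
    refine ⟨hσ.1, ?_⟩
    rw [cechSet_cons]
    exact Set.subset_inter hσi hσ.2
  have h0 : sEvalSimplex (cechSδ I R N U (p + 1) q c (Fin.cons i J : Fin (p + 3) → ι)) σ = 0 := by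
    rw [hc, Pi.zero_apply, sEvalSimplex_of_isSmoothIn _ hσc, LinearMap.zero_apply]
  rw [sEvalSimplex_cechSδ U c hσc,
    CechTuple.sum_neg_one_pow_smul_cons_faces (R := R) i J (fun S ↦ sEvalSimplex (c S) σ), sub_eq_zero] at h0
  exact h0

/-- **The cocycle identity in the column `0`**: if `δ c = 0` for a `0`-cochain `c` then
`c_{(i)}(σ) = c_J(σ)` for a smooth `σ ⊆ U_i ∩ U_J`, `J` a `1`-tuple. [cite: BottTu1982Forms, Prop. 8.5] -/
theorem sEvalSimplex_eq_sEvalSimplex_of_cechSδ_eq_zero {q : ℕ} {c : CechSCochain I R N U 0 q}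
    (hc : cechSδ I R N U 0 q c = 0) (J : Fin 1 → ι) (i : ι) {σ : SingularSimplex M q}
    (hσi : σ.range ⊆ U i) (hσ : IsSmoothIn I (cechSet U J) σ) :
    sEvalSimplex (c fun _ ↦ i) σ = sEvalSimplex (c J) σ := by
  have hσc : IsSmoothIn I (cechSet U (Fin.cons i J : Fin 2 → ι)) σ := by
    refine ⟨hσ.1, ?_⟩
    rw [cechSet_cons]
    exact Set.subset_inter hσi hσ.2
  have h0 : sEvalSimplex (cechSδ I R N U 0 q c (Fin.cons i J : Fin 2 → ι)) σ = 0 := by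
    rw [hc, Pi.zero_apply, sEvalSimplex_of_isSmoothIn _ hσc, LinearMap.zero_apply]
  rw [sEvalSimplex_cechSδ U c hσc, Fin.sum_univ_two, Fin.val_zero, pow_zero, one_smul, Fin.val_one,
    pow_one, neg_one_smul, add_neg_eq_zero] at h0
  have e0 : ((Fin.cons i J : Fin 2 → ι) ∘ Fin.succAbove (0 : Fin 2)) = J :=
    CechTuple.cons_comp_succAbove_zero i J
  have e1 : ((Fin.cons i J : Fin 2 → ι) ∘ Fin.succAbove (1 : Fin 2)) = fun _ ↦ i := by
    funext k
    rw [Subsingleton.elim k 0]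
    rfl
  have f0 := congrArg (fun S : Fin 1 → ι ↦ sEvalSimplex (c S) σ) e0
  have f1 := congrArg (fun S : Fin 1 → ι ↦ sEvalSimplex (c S) σ) e1
  exact (f0.symm.trans (h0.trans f1)).symm

/-- **Exactness of the Čech rows in positive columns** for the presheaf of smooth singular cochains
of ANY family of subsets: if `δ c = 0` then `c = δ (h c)`. [cite: BottTu1982Forms, Prop. 8.5] -/
theorem cechSmoothSingular_rowExact : (cechSmoothSingular I R N U).RowExact := by
  refine ⟨fun p q c hc ↦ ⟨cechSContract U c, ?_⟩⟩
  funext T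
  refine ext_sEvalSimplex fun σ hσ ↦ ?_
  change sEvalSimplex (cechSδ I R N U p q (cechSContract U c) T) σ = sEvalSimplex (c T) σ
  rw [sEvalSimplex_cechSδ U _ hσ]
  have hσ0 : σ.range ⊆ U (T 0) := hσ.2.trans (cechSet_subset_apply U T 0)
  calc ∑ j : Fin (p + 2), (-1 : R) ^ (j : ℕ) • sEvalSimplex (cechSContract U c (T ∘ Fin.succAbove j)) σ
      = ∑ j : Fin (p + 2), (-1 : R) ^ (j : ℕ) •
          sEvalSimplex (c (Fin.cons (smallIdx U T σ) (T ∘ Fin.succAbove j) : Fin (p + 2) → ι)) σ := by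
        refine Finset.sum_congr rfl fun j _ ↦ ?_
        rw [sEvalSimplex_cechSContract U c _ (hσ.mono (cechSet_subset_comp U T _)),
          smallIdx_eq_smallIdx U (T ∘ Fin.succAbove j) T hσ0]
    _ = sEvalSimplex (c T) σ :=
        (sEvalSimplex_eq_sum_of_cechSδ_eq_zero U hc T (smallIdx U T σ) (subset_smallIdx U T hσ0) hσ).symm

/-- **The smooth small chains degreewise**: `(Δ^{sm} ⊓ C^𝔘)_q = Σ_i Δ^{sm}_q(U_i)` (both are the
chains supported on the smooth simplices lying in some `U_i`). [cite: Bredon1993, §V.9] -/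
theorem smoothSmallSub_apply (q : ℕ) :
    smoothSmallSub I R U q = ⨆ i, smoothChainsInSub I R R M (U i) q := by
  apply le_antisymm
  · rintro c ⟨hcs, hcU⟩
    -- decompose `c` simplex by simplex
    classical
    rw [← Finsupp.sum_single c, Finsupp.sum]
    refine Submodule.sum_mem _ fun σ hσ ↦ ?_
    have hs := (mem_smoothChains_iff _).1 hcs σ hσ
    have hU : ∃ i, SingularSimplex.range σ ⊆ U i := by
      change c ∈ smallChains R R M U q at hcU
      have hmono : smallChains R R M U q ≤
          Finsupp.supported R R (⋃ i, simplicesIn M (U i) q) := by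
        refine iSup_le fun i ↦ ?_
        exact Finsupp.supported_mono (Set.subset_iUnion (fun i ↦ simplicesIn M (U i) q) i)
      have h := (Finsupp.mem_supported R c).1 (hmono hcU) hσ
      obtain ⟨i, hi⟩ := Set.mem_iUnion.1 h
      exact ⟨i, hi⟩
    obtain ⟨i, hi⟩ := hU
    exact Submodule.mem_iSup_of_mem i (single_mem_smoothChainsInSub hs hi _)
  · refine iSup_le fun i ↦ ?_
    exact le_inf (smoothChainsInSub_le_smoothSub _ q)
      ((smoothChainsInSub_le_chainsInSub _ q).trans
        (fun c hc ↦ Submodule.mem_iSup_of_mem (p := fun i ↦ chainsIn R R M (U i) q) i hc))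

open Classical in
/-- **Gluing a `0`-cocycle of smooth cochains into a smooth small cochain**: `a(σ) = c_{(i(σ))}(σ)` on
the basis of smooth small simplices. [cite: BottTu1982Forms, Prop. 8.5] -/
def glueSmoothSmall {q : ℕ} (c : CechSCochain I R N U 0 q) : SmoothSmallCochain I R N U q where
  toFun x := Finsupp.linearCombination R (fun σ : SingularSimplex M q ↦
      if h : ∃ i, σ.range ⊆ U i then sEvalSimplex (c fun _ ↦ h.choose) σ else 0) x.1
  map_add' x y := map_add _ x.1 y.1
  map_smul' r x := map_smul _ r x.1

/-- **Exactness of the augmented rows at the column `0`**: the restriction to the pieces is injective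
on smooth small cochains, and a `δ`-cocycle of smooth cochains glues to a smooth small cochain.
[cite: BottTu1982Forms, Prop. 8.5] -/
theorem cechSmoothSingularRow_exact : (cechSmoothSingularRow I R N U).Exact := by
  classical
  constructor
  · -- injectivity
    intro q
    rw [injective_iff_map_eq_zero]
    intro a ha
    refine LinearMap.ext fun x ↦ ?_
    suffices h : ∀ (y : CChain R M q) (hy : y ∈ ⨆ i, smoothChainsInSub I R R M (U i) q),
        a ⟨y, (smoothSmallSub_apply (I := I) (R := R) U q).symm ▸ hy⟩ = 0 by
      have hx : (x.1 : CChain R M q) ∈ ⨆ i, smoothChainsInSub I R R M (U i) q := by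
        rw [← smoothSmallSub_apply (I := I) (R := R)]; exact x.2
      have := h x.1 hx
      exact this
    intro y hy
    induction hy using Submodule.iSup_induction' with
    | mem i y hy =>
      have hJ : y ∈ smoothChainsInSub I R R M (cechSet U (fun _ : Fin 1 ↦ i)) q :=
        smoothChainsInSub_mono (I := I) (R := R) (A := R) (M := M) (subset_cechSet_fin_one U fun _ ↦ i) q hy
      have h := congrArg (fun c : CechSCochain I R N U 0 q ↦ c (fun _ ↦ i) ⟨y, hJ⟩) ha
      exact h
    | zero => exact map_zero a
    | add y z hy hz ihy ihz =>
      have hy' : y ∈ smoothSmallSub I R U q := (smoothSmallSub_apply (I := I) (R := R) U q).symm ▸ hy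
      have hz' : z ∈ smoothSmallSub I R U q := (smoothSmallSub_apply (I := I) (R := R) U q).symm ▸ hz
      have e : (⟨y + z, (smoothSmallSub_apply (I := I) (R := R) U q).symm ▸ Submodule.add_mem _ hy hz⟩ :
          (smoothSmallSub I R U).toComplex.X q) =
        (⟨y, hy'⟩ : (smoothSmallSub I R U).toComplex.X q) + (⟨z, hz'⟩ : (smoothSmallSub I R U).toComplex.X q) :=
        rfl
      rw [e, map_add, ihy, ihz, add_zero]
  · -- gluing
    intro q c hc
    refine ⟨glueSmoothSmall U c, ?_⟩
    funext J
    refine ext_sEvalSimplex fun σ hσ ↦ ?_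
    have hσ0 : σ.range ⊆ U (J 0) := hσ.2.trans (cechSet_subset_apply U J 0)
    have hex : ∃ i, σ.range ⊆ U i := ⟨J 0, hσ0⟩
    rw [sEvalSimplex_of_isSmoothIn _ hσ, cechSmoothSingularRow_ε_apply_sElemChain]
    change Finsupp.linearCombination R _ (Finsupp.single σ 1) = _
    rw [Finsupp.linearCombination_single, one_smul, dif_pos hex]
    exact sEvalSimplex_eq_sEvalSimplex_of_cechSδ_eq_zero U hc J hex.choose hex.choose_spec hσ

/-! ### The column augmentation: smooth `0`-cocycles -/

variable (I R N) in
/-- **The smooth `0`-cocycles** `Z⁰_{sm}(A; N) = ker (δ : C⁰_{sm}(A) → C¹_{sm}(A))` (cochains constant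
along smooth paths of `A`). [cite: Bredon1993, §V.9] -/
abbrev zeroSCocycles (A : Set M) : Submodule R (SCochainOn I R N A 0) :=
  LinearMap.ker (scod A 0)

/-- Restriction preserves smooth `0`-cocycles. [folklore] -/
theorem scres_mem_zeroSCocycles {A B : Set M} (h : A ⊆ B) {ψ : SCochainOn I R N B 0}
    (hψ : ψ ∈ zeroSCocycles I R N B) : scres h 0 ψ ∈ zeroSCocycles I R N A := by
  rw [LinearMap.mem_ker] at hψ ⊢
  rw [← scres_scod, hψ, map_zero]

variable (I R N) in
/-- **The Čech `p`-cochains with values in smooth `0`-cocycles**, `C^p(𝔘, Z⁰_{sm})`.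
[cite: BottTu1982Forms, Thm. 8.9] -/
abbrev CechZeroSCocycles (U : ι → Set M) (p : ℕ) : Type _ :=
  ∀ J : Fin (p + 1) → ι, ↥(zeroSCocycles I R N (cechSet U J))

variable (I R N) in
/-- **The Čech differential on smooth `0`-cocycles** (same formula (8.4)). [cite: BottTu1982Forms, §8 (8.4)] -/
def cechZeroSδ (p : ℕ) : CechZeroSCocycles I R N U p →ₗ[R] CechZeroSCocycles I R N U (p + 1) where
  toFun b J := ∑ j : Fin (p + 2), (-1 : R) ^ (j : ℕ) •
    (⟨scres (cechSet_subset_comp U J (Fin.succAbove j)) 0 (b (J ∘ Fin.succAbove j)),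
      scres_mem_zeroSCocycles _ (b _).2⟩ : zeroSCocycles I R N (cechSet U J))
  map_add' b b' := by
    funext J
    apply Subtype.ext
    simp only [Pi.add_apply, Submodule.coe_add, Submodule.coe_sum, Submodule.coe_smul, map_add,
      smul_add, Finset.sum_add_distrib]
  map_smul' r b := by
    funext J
    apply Subtype.ext
    simp only [Pi.smul_apply, Submodule.coe_smul, Submodule.coe_sum, map_smul, RingHom.id_apply,
      Finset.smul_sum, smul_smul, mul_comm r]

/-- The Čech differential on smooth `0`-cocycles, on underlying cochains. [cite: BottTu1982Forms, §8 (8.4)] -/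
theorem coe_cechZeroSδ_apply {p : ℕ} (b : CechZeroSCocycles I R N U p) (J : Fin (p + 2) → ι) :
    (cechZeroSδ I R N U p b J : SCochainOn I R N (cechSet U J) 0) = ∑ j : Fin (p + 2), (-1 : R) ^ (j : ℕ) •
      scres (cechSet_subset_comp U J (Fin.succAbove j)) 0
        (b (J ∘ Fin.succAbove j) : SCochainOn I R N (cechSet U (J ∘ Fin.succAbove j)) 0) := by
  change ((∑ j : Fin (p + 2), (-1 : R) ^ (j : ℕ) •
    (⟨scres (cechSet_subset_comp U J (Fin.succAbove j)) 0 (b (J ∘ Fin.succAbove j)),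
      scres_mem_zeroSCocycles _ (b _).2⟩ : zeroSCocycles I R N (cechSet U J)) :
        zeroSCocycles I R N (cechSet U J)) : SCochainOn I R N (cechSet U J) 0) = _
  rw [Submodule.coe_sum]
  simp only [Submodule.coe_smul]

variable (I R N) in
/-- The inclusion `Z⁰_{sm}(U_J) ↪ C⁰_{sm}(U_J)` on Čech cochains. [folklore] -/
def cechZeroSIncl (p : ℕ) : CechZeroSCocycles I R N U p →ₗ[R] CechSCochain I R N U p 0 where
  toFun b J := (b J : SCochainOn I R N (cechSet U J) 0)
  map_add' _ _ := rfl
  map_smul' _ _ := rfl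

variable (I R N) in
/-- **The column augmentation** by the Čech complex of smooth `0`-cocycles. [cite: BottTu1982Forms, Thm. 8.9] -/
def cechSmoothSingularCol : (cechSmoothSingular I R N U).ColAugmentation (CechZeroSCocycles I R N U) where
  dA p := cechZeroSδ I R N U p
  ε p := cechZeroSIncl I R N U p
  ε_dA p b := by
    funext J
    change (cechZeroSδ I R N U p b J : SCochainOn I R N (cechSet U J) 0) =
      cechSδ I R N U p 0 (cechZeroSIncl I R N U p b) J
    rw [coe_cechZeroSδ_apply, cechSδ_apply]
    rfl
  δ_ε p b := by
    funext J
    change (-1 : R) ^ p • scod (cechSet U J) 0 (b J : SCochainOn I R N (cechSet U J) 0) = 0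
    rw [LinearMap.mem_ker.1 (b J).2, smul_zero]

/-- **Exactness of the augmented columns at the row `0`** (tautological: `Z⁰ = ker δ₀`).
[cite: BottTu1982Forms, Thm. 8.9] -/
theorem cechSmoothSingularCol_exact : (cechSmoothSingularCol I R N U).Exact := by
  constructor
  · intro p b b' h
    funext J
    apply Subtype.ext
    exact congrArg (fun c : CechSCochain I R N U p 0 ↦ c J) h
  · intro p c hc
    have hker : ∀ J, c J ∈ zeroSCocycles I R N (cechSet U J) := fun J ↦ by
      rw [LinearMap.mem_ker]
      have h := congrFun hc J
      change (-1 : R) ^ p • scod (cechSet U J) 0 (c J) = 0 at h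
      exact (neg_one_pow_smul_eq_zero_iff p _).1 h
    exact ⟨fun J ↦ ⟨c J, hker J⟩, rfl⟩

/-- **Exactness of the columns in positive rows from acyclicity of the finite intersections**: if
every `U_J` has exact smooth cochain complex in positive degrees (`H^{q+1}_{sm}(U_J; N) = 0`, e.g.
`U_J` chart-convex by the Poincaré lemma and the de Rham isomorphism of `U_J`), the columns are exact
in positive degrees. [cite: BottTu1982Forms, Thm. 8.9] -/
theorem cechSmoothSingular_colExact
    (hacyc : ∀ (p q : ℕ) (J : Fin (p + 1) → ι) (ψ : SCochainOn I R N (cechSet U J) (q + 1)),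
      scod (cechSet U J) (q + 1) ψ = 0 → ∃ φ : SCochainOn I R N (cechSet U J) q, scod (cechSet U J) q φ = ψ) :
    (cechSmoothSingular I R N U).ColExact := by
  refine ⟨fun p q c hc ↦ ?_⟩
  have hex : ∀ J, ∃ φ : SCochainOn I R N (cechSet U J) q, scod (cechSet U J) q φ = c J := fun J ↦ by
    apply hacyc
    have h := congrFun hc J
    change (-1 : R) ^ p • scod (cechSet U J) (q + 1) (c J) = 0 at h
    exact (neg_one_pow_smul_eq_zero_iff p _).1 h
  choose φ hφ using hex
  refine ⟨fun J ↦ (-1 : R) ^ p • φ J, ?_⟩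
  funext J
  change (-1 : R) ^ p • scod (cechSet U J) q ((-1 : R) ^ p • φ J) = c J
  rw [map_smul, smul_smul, ← pow_add, ← two_mul, pow_mul, neg_one_sq, one_pow, one_smul, hφ]

/-! ### The comparison -/

/-- **Čech comparison for the smooth singular cochains of an acyclic family** (Leray's acyclic-cover
theorem / Bott–Tu Thm. 8.9 with Thm. 15.8, smooth chains): if every finite intersection `U_J` of `𝔘`
has exact smooth cochain complex in positive degrees, the cohomology of the smooth `𝔘`-small cochains
`Hom(Δ^{sm,𝔘}, N)` is isomorphic in every degree to the cohomology of the Čech complex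
`(C^•(𝔘, Z⁰_{sm}), δ)` of smooth `0`-cocycles. [cite: BottTu1982Forms, Thm. 15.8] -/
def cechSmoothSingularEquiv
    (hacyc : ∀ (p q : ℕ) (J : Fin (p + 1) → ι) (ψ : SCochainOn I R N (cechSet U J) (q + 1)),
      scod (cechSet U J) (q + 1) ψ = 0 → ∃ φ : SCochainOn I R N (cechSet U J) q, scod (cechSet U J) q φ = ψ)
    (n : ℕ) :
    NatCochain.Cohomology (cechSmoothSingularRow I R N U).dA n ≃ₗ[R]
      NatCochain.Cohomology (cechZeroSδ I R N U) n :=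
  ADoubleComplex.rowColEquiv (cechSmoothSingularRow I R N U) (cechSmoothSingularCol I R N U)
    (cechSmoothSingular_rowExact U) (cechSmoothSingularRow_exact U) (cechSmoothSingular_colExact U hacyc)
    (cechSmoothSingularCol_exact U) n

end Cech

end Literature.Geometry.Manifold

end
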